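import Summits.BirchSwinnertonDyer.Rank1Residual.Additive.N10LowerHalfStatements
import Summits.BirchSwinnertonDyer.Rank1Residual.X4.KimShaLengthFiveLe
import HarnessLib
import HarnessLib.Audit.Tags

/-!
# N10, cell (G-ord, `e = 2`) ∩ X4, analytic rank `0`: the TAMAGAWA-TOLERANT twist-transport chain [C′] —
# BSTW Thm. 9.21(c) twist clause ∘ Castella–Sano 2026 Thm. 1 ∘ Kim 2026 Thm. 1.8 (6) (cell `bsd-addord`,
# seat `bsd-addord-twist`; the cell planner's request R-CS, `run/shared/lean/pub/bsd-addord/TARGET.md` v2 §8)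

HONEST FRAMING (cell `bsd-addord`, README §4): the programme's target is full BSD for every `E/ℚ` of
analytic rank `≤ 1`; this file concerns the LOWER half (indeed the whole `p`-part) on ONE slice of class
N10 — an additive prime `p ≥ 5` of Kodaira type `I₀*` whose quadratic twist `E♭ = E^{(p*)}` is good
ordinary, `ρ̄_{E,p}` onto, a (ram) prime — and books NOTHING: BOTH Iwasawa-theoretic inputs are
UNREFEREED preprints, typed below as ONE explicit OPEN hypothesis in the tree's Kurihara-number
currency (never a `_holds`). Sibling of `Additive/N10TwistClauseBSTW121c.lean` (chain [C]: the same
twist clause read in Greenberg–Delbourgo form through Delbourgo's control, Tamagawa-free but needing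
non-CM / non-anomalous); this chain [C′] instead reads it through Kim's structure theorem, is
TAMAGAWA-TOLERANT and needs no Delbourgo control, no non-anomalous and no CM hypothesis, at the price of
a modular-parametrisation datum with `p ∤ c_φ` (Manin) and a SECOND preprint. One definition (the OPEN
hypothesis) and bookkeeping theorems; every published input is an explicit named-fact binder.

## The chain (planner R-CS; lit dossier `HOME/lit/castellasano2026/STATEMENTS.md` R1–R6)

* [I] Burungale–Skinner–Tian–Wan, arXiv:2409.01350v2 **Thm. 9.21(c)** (§9.4.1, PDF p. 84; printed as
  "1.21(c)" in the held TeX chunking), twist clause: for `g ∈ S₂(Γ₀(N))`, `p ∤ 6N` ordinary, (irr_ℚ),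
  `K/ℚ` quadratic with `p ∣ disc(K)` and (ram_K), Kato's main conjecture holds integrally for
  `g_K = g ⊗ χ_K`. With `g = f_{E♭}`, `K = ℚ(√p*)`: Kato's IMC for `f_E` over `ℚ_∞`. [PRE, 25-line sketch.]
* [CS] F. Castella, T. Sano, arXiv:2601.14504v1 (20 Jan 2026) **Theorem 1**: "Let `p > 3` be a prime such
  that (sur) and (`p ∤ c_φ`) both hold. Then the following are equivalent: (i) `𝓜_∞(δ) = ord_p(Tam_E)`
  … (ii) The Iwasawa Main Conjecture 2.2.2 for `ℚ_∞/ℚ` holds" — 2.2.2 = Kato's IMC "in the formulation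
  of [kataoka-sano]", Prop. 2.2.3: ⟺ `char_Λ(H¹(ℤ_S,𝐓)/Λ·z_∞^{(S)}) = char_Λ(H²(ℤ_S,𝐓))`; NO
  reduction hypothesis at `p` (standing hypotheses §1.1.1: `E` non-CM — automatic under (sur) at
  `p ≥ 5` —, (sur), (`p ∤ c_φ`); lit flag R3: in §2.3 read "`ℓ ∣ N`" as "`ℓ ∣ N, ℓ ≠ p`"). [PRE.]
* [K] C.-H. Kim, Amer. J. Math. 148 (2026) Thm. 1.8 (6) (PUBLISHED; tree facts
  `Kim2026.rankZero_le_padicValNat_sha_of_kuriharaNumber_ne_zero`,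
  `Kim2026.rankZero_padicValNat_sha_add_le_of_forall_pow_dvd_kuriharaNumber_cyclicLevel`), through the
  kernel theorem `X4.bsdp_iff_kimTamagawaDefectAt_of_kimFacts_of_five_le`
  (`X4/KimShaLengthFiveLe.lean`): at `p ≥ 5`, `r_an = 0`, `ρ̄` onto, Manin datum with `p ∤ c`, period
  transfer: `BSD(E,p) ⟺ X4.KimTamagawaDefectAt W p D.f` (`∂^{(∞)}(δ̃) = ord_p ∏_v c_v`, Kim Conj. 1.10 =
  CS Conj. 2, typed in `X4/KimTamagawaDefect.lean`).
So [I] ∘ [CS] (ii)⇒(i) deliver `X4.KimTamagawaDefectAt` on the slice, and [K] turns it into `BSD(E,p)`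
EXACTLY, on the Tamagawa rows too (where the unit-Kurihara joint of Kim Thm. 1.10 provably fails:
`X4.not_kuriharaUnitAt_of_bsdp_of_dvd_tamagawaProduct`). DICTIONARY (as in the sibling file): `g = f_{E♭}`,
`p ∤ 6N_g ⟺ p ≥ 5`; ordinary ⟺ (G-ord, e=2) (`N10.CellGordTwo`); (irr_ℚ)/(sur) ⟺ `Surj W p`; (ram_K) ⟺
`Ram W p`; CS's `𝓜_∞(δ)`, `Tam_E` ⟺ the tree's `kuriharaPartialInfty W p D.f`, `W.tamagawaProduct`
(cyclic Kolyvagin levels, flag `Kim2026-(6)-cyclic-reading`; `∏_v c_v` over all bad `v`, `c_p ≤ 4` at an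
additive `p ≥ 5`).

## What is typed; what this is NOT

`BSTW921c_CastellaSano2026_kimTamagawaDefect_OPEN` = [I]∘[CS] read in Kurihara currency: on the slice,
for every modular parametrisation datum `D` with `p ∤ c`, `X4.KimTamagawaDefectAt W p D.f`. The joint
between [I]'s Kato-form (Kato 2004 Conj. 12.10, `X_st`/fine Selmer) and [CS]'s formulation 2.2.2
(Kataoka–Sano determinant form; CS Prop. 2.2.3 + "a reformulation of [kato-euler-systems]", chunk4
L49–52) is part of the hypothesis. Consumers: `N10.bsdp_cellGordTwo_of_BSTW921c_CastellaSano_OPEN`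
(`BSD(E,p)` in analytic rank `0` on (G-ord, e=2) ∩ {`p ≥ 5`, `ρ̄` onto, (ram)} given a Manin datum and the
period transfer — Tamagawa-, CM- and anomalous-free) and its `MissingLowerBoundAt` corollary. NOT a
proof of anything unconditionally; not rank `1` (CS Thm. 3 is good ordinary, `p` unramified in `K`); not
`p = 3` ("`p > 3`" in [CS], "`p ∤ 6N`" in [I]); not the (M) cell (`p ‖ N_g` is outside [I]); not X3
((sur) fails). Reach (seat census, memo App. D, N < 5·10⁵): the V1 slice r0 = 37 844 classes, of which
94 CONTENT classes (`#Ш_an = p²`), 93 with a Tamagawa-free member — [C′] also covers the `p ∣ ∏c_ℓ`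
members that [C] reaches only off the anomalous/CM rows.

References: Burungale–Skinner–Tian–Wan arXiv:2409.01350v2 Thm. 9.21(c) [BurungaleSkinnerTianWan2024];
Castella–Sano arXiv:2601.14504v1 Thm. 1, Conj. 2, §2.2 [CastellaSano2026]; C.-H. Kim, Amer. J. Math. 148
(2026) Thm. 1.8 (6), Conj. 1.10 [Kim2022StructureSelmer]; R. L. Miller, LMS J. Comput. Math. 14 (2011)
Def. 1.1 [Miller2011LMS].
-/

noncomputable section

open scoped Classical MatrixGroups ModularForm

open CongruenceSubgroup WeierstrassCurve Literature.NumberTheory.EllipticCurves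
  Literature.NumberTheory.EllipticCurves.ModularForms
  Literature.NumberTheory.EllipticCurves.Rank1Residual
  Literature.NumberTheory.EllipticCurves.Rank1Residual.Typed

namespace Summit.BirchSwinnertonDyer.Rank1Residual.Additive

/-! ## §1 The composite OPEN hypothesis [I] ∘ [CS] in Kurihara currency -/

/-- **OPEN HYPOTHESIS — TWO UNREFEREED PREPRINTS COMPOSED: BSTW arXiv:2409.01350v2 Thm. 9.21(c) (twist
clause: Kato's IMC for `f_E = f_{E♭} ⊗ χ_K`) ∘ Castella–Sano arXiv:2601.14504v1 Thm. 1 ((ii) ⇒ (i):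
Kato's IMC for `ℚ_∞/ℚ` ⇒ `𝓜_∞(δ) = ord_p(Tam_E)`, `p > 3`, (sur), `p ∤ c_φ`, any reduction at `p`),
read in the tree's Kurihara currency.** On the slice {`W` globally minimal, `p ≥ 5`, `(E,p)` in cell
(G-ord, `e = 2`) (`N10.CellGordTwo`), `ρ̄_{E,p}` onto (`Surj`), a (ram) prime `ℓ ≠ p` (`Ram`)}: for every
modular parametrisation datum `D` of `W` with `p ∤ D.maninConstant`, Kim's Tamagawa-defect identity
`X4.KimTamagawaDefectAt W p D.f` (`∂^{(∞)}(δ̃) = ord_p ∏_v c_v`). NEVER cite this `Prop` as a theorem;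
take it as an explicit hypothesis. [claim: BurungaleSkinnerTianWan2024, status: under-review]
[claim: CastellaSano2026, status: under-review] -/
def BSTW921c_CastellaSano2026_kimTamagawaDefect_OPEN : Prop :=
  ∀ (W : WeierstrassCurve ℚ) [W.IsElliptic] [W.IsGloballyMinimal] (p : ℕ) [Fact p.Prime],
    5 ≤ p → N10.CellGordTwo W p → Surj W p → Ram W p →
    ∀ {N : ℕ} [NeZero N] (D : ModularParametrizationData W N), ¬ (p : ℤ) ∣ D.maninConstant →
      X4.KimTamagawaDefectAt W p D.f

/-! ## §2 Consequences on the slice (bookkeeping against the kernel's Kim consumer) -/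

section Consequences

variable (W : WeierstrassCurve ℚ) [W.IsElliptic] [W.IsGloballyMinimal] (p : ℕ) [hp : Fact p.Prime]

/-- The composite hypothesis at a pair of the slice delivers `X4.KimTamagawaDefectAt W p D.f`
(instantiation). [claim: BurungaleSkinnerTianWan2024, status: under-review] [claim: CastellaSano2026, status: under-review] -/
theorem N10.kimTamagawaDefectAt_of_BSTW921c_CastellaSano_OPEN
    (hO : BSTW921c_CastellaSano2026_kimTamagawaDefect_OPEN)
    (hp5 : 5 ≤ p) (hc : N10.CellGordTwo W p) (hsurj : Surj W p) (hram : Ram W p)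
    {N : ℕ} [NeZero N] (D : ModularParametrizationData W N) (hcM : ¬ (p : ℤ) ∣ D.maninConstant) :
    X4.KimTamagawaDefectAt W p D.f :=
  hO W p hp5 hc hsurj hram D hcM

/-- **Chain [C′]: `BSD(E,p)` in analytic rank `0`, TAMAGAWA-TOLERANT.** IF the composite hypothesis
[I]∘[CS] (`hO`) holds, then for `(E,p)` in cell (G-ord, `e = 2`) with `p ≥ 5`, `ord_{s=1} L(E,s) = 0`,
`ρ̄_{E,p}` onto, a (ram) prime, and a modular parametrisation datum `D` at level `N_E` with `p ∤ c`
(Manin) and `Ω_E = u·Ω⁺_{D.f}`, `|u|_p = 1`: Miller's `BSD(E,p)` — by Kim 2026 Thm. 1.8 (6) (published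
named facts `hKimk`, `hE67c`) through the kernel's `X4.bsdp_iff_kimTamagawaDefectAt_of_kimFacts_of_five_le`,
with GZK and modularity. No Tamagawa, CM, anomalous or Delbourgo-control hypothesis. Conditional on
two unrefereed claims; nothing booked. [claim: BurungaleSkinnerTianWan2024, status: under-review]
[claim: CastellaSano2026, status: under-review] [cite: Kim2022StructureSelmer, Thm. 1.9 (6) and Conj. 1.10 (PDF p. 8)]
[cite: Miller2011LMS, §1 and Def. 1.1] -/
theorem N10.bsdp_cellGordTwo_of_BSTW921c_CastellaSano_OPEN
    (hO : BSTW921c_CastellaSano2026_kimTamagawaDefect_OPEN)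
    (hKimk : Kim2026.rankZero_le_padicValNat_sha_of_kuriharaNumber_ne_zero)
    (hE67c : Kim2026.rankZero_padicValNat_sha_add_le_of_forall_pow_dvd_kuriharaNumber_cyclicLevel)
    (hGZK : rank_eq_analyticRank_of_analyticRank_le_one) (hmod : hasEntireLFunction_rat)
    (hp5 : 5 ≤ p) (hr : W.analyticRank = 0) (hc : N10.CellGordTwo W p) (hsurj : Surj W p)
    (hram : Ram W p) {N : ℕ} [NeZero N] (D : ModularParametrizationData W N)
    (hN : W.conductorNorm ℤ = N) (hcM : ¬ (p : ℤ) ∣ D.maninConstant)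
    (hper : ∃ u : ℚ, ‖(u : ℚ_[p])‖ = 1 ∧ W.realPeriodRat = u * plusPeriod D.f) : BSDp W p :=
  (X4.bsdp_iff_kimTamagawaDefectAt_of_kimFacts_of_five_le W p hKimk hE67c hGZK hmod hp5 hr hsurj D hN
      hcM hper).mpr (hO W p hp5 hc hsurj hram D hcM)

/-- **Chain [C′], lower half.** The `MissingLowerBoundAt` corollary (what class N10 lacks), for the
planner's ledger row. [claim: BurungaleSkinnerTianWan2024, status: under-review] [claim: CastellaSano2026, status: under-review]
[cite: Miller2011LMS, Def. 1.1] -/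
theorem N10.missingLowerBoundAt_cellGordTwo_of_BSTW921c_CastellaSano_OPEN
    (hO : BSTW921c_CastellaSano2026_kimTamagawaDefect_OPEN)
    (hKimk : Kim2026.rankZero_le_padicValNat_sha_of_kuriharaNumber_ne_zero)
    (hE67c : Kim2026.rankZero_padicValNat_sha_add_le_of_forall_pow_dvd_kuriharaNumber_cyclicLevel)
    (hGZK : rank_eq_analyticRank_of_analyticRank_le_one) (hmod : hasEntireLFunction_rat)
    (hp5 : 5 ≤ p) (hr : W.analyticRank = 0) (hc : N10.CellGordTwo W p) (hsurj : Surj W p)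
    (hram : Ram W p) {N : ℕ} [NeZero N] (D : ModularParametrizationData W N)
    (hN : W.conductorNorm ℤ = N) (hcM : ¬ (p : ℤ) ∣ D.maninConstant)
    (hper : ∃ u : ℚ, ‖(u : ℚ_[p])‖ = 1 ∧ W.realPeriodRat = u * plusPeriod D.f) :
    MissingLowerBoundAt W p := by
  have hr1 : W.analyticRank ≤ 1 := by rw [hr]; exact zero_le_one
  haveI : Finite W.sha := (hGZK W hr1).2
  exact (lower_and_upper_of_missingPPartAt W p (missingPPartAt_of_bsdp W p
    (N10.bsdp_cellGordTwo_of_BSTW921c_CastellaSano_OPEN W p hO hKimk hE67c hGZK hmod hp5 hr hc hsurj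
      hram D hN hcM hper))).1

end Consequences

end Summit.BirchSwinnertonDyer.Rank1Residual.Additive

end
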